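import Literature.Analysis.FluidPDE.LerayHopfRestart
import Literature.Analysis.FluidPDE.NSLerayExistenceR3Holds
import Literature.Analysis.FluidPDE.HouWangYang2025Nonuniqueness
import HarnessLib

/-!
# Concatenation and global continuation of Leray–Hopf weak solutions

Analysis/FluidPDE support file (proofs only; no new definitions). For the tree's notion of a
Leray–Hopf weak solution `Literature.Analysis.FluidPDE.IsLerayHopfOn T ν 0 u₀ u` of the unforced
Navier–Stokes system on `E × [0, T)` we prove:

* `IsLerayHopfOn.weakIdentity_final` — the weak formulation **up to the final time**: for every
  space–time test field `ψ` with divergence-free slices (not required to vanish near `t = T`),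
  `∫₀ᵀ ∫ (⟪u, ∂ₜψ⟫ + ⟪u, (u·∇)ψ⟫ + ν ⟪u, Δψ⟫) + ∫ ⟪u₀, ψ(0)⟫ = ∫ ⟪u(T), ψ(T)⟫`
  (cut off near `t = T` and use the weak continuity of `t ↦ u(t)` at `T`);
* `IsLerayHopfOn.concat` — **concatenation**: if `u` is Leray–Hopf on `[0, T₁)` from `u₀` and
  `w` is Leray–Hopf on `[0, S)` from the final slice `u(T₁)`, then the glued field
  (`u` on `[0, T₁]`, `w(· - T₁)` after) is Leray–Hopf on `[0, T₁ + S)` from `u₀`;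
* `IsLerayHopfOn.exists_isGlobalLerayHopf_extension` — on `ℝ³`, with `ν > 0`, every Leray–Hopf
  weak solution on `[0, T)` **agrees on `(0, T]` with a global Leray–Hopf weak solution** from the
  same datum (continue from `u(T) ∈ L²_σ` by Leray's existence theorem
  `Literature.Analysis.FluidPDE.leray_existence_R3_holds` and concatenate).

The last statement is exactly the continuation hypothesis `hext` of
`Literature.Analysis.FluidPDE.LerayHopfNonUniqueness.of_isLerayHopfOn` and of
`Literature.Analysis.FluidPDE.HouWangYang2025.IsNonuniqueFamily.lerayHopfNonUniqueness` /
`….energyClassNonUniqueness`; the corresponding hypothesis-free corollaries are recorded at the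
end of the file.

## Proof

* *Final time.* Test the weak formulation with `η_δ(T - t) ψ(t, x)`, `η_δ` the smooth monotone
  cut-off of `Literature.Analysis.FluidPDE.exists_smooth_time_cutoff` (`= 0` on `(-∞, δ]`, `= 1`
  on `[3δ, ∞)`), a test field supported in `(-∞, T - δ] × K`; its slices are divergence free.
  As `δ → 0`, `∫∫ η_δ(T - t) Φ → ∫∫ Φ` by dominated convergence, and
  `∫ η_δ'(T - t) ⟨u(t), ψ(t)⟩ dt → ⟨u(T), ψ(T)⟩` by the approximate-identity lemma
  `Literature.Analysis.FluidPDE.tendsto_setIntegral_mul_of_ae_tendsto` after the substitution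
  `t ↦ T - t`, because `t ↦ ⟨u(t), ψ(t)⟩` is left-continuous at `T`: `⟨u(t), ψ(T)⟩ → ⟨u(T), ψ(T)⟩`
  by the weak `L²`-continuity of a Leray–Hopf solution on `(0, T]`, and
  `|⟨u(t), ψ(t) - ψ(T)⟩| ≤ ‖u(t)‖_{L¹(K)} sup |ψ(t) - ψ(T)| → 0` by the uniform continuity of `ψ`
  and the energy bound `½‖u(t)‖₂² ≤ ½‖u₀‖₂²` (`ν ≥ 0`).
* *Concatenation.* The weak formulation of the glued field against a test field `ψ` on
  `(-∞, T₁ + S) × E` splits at `T₁`: on `(0, T₁)` it is the final-time identity of `u`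
  (boundary term `+⟨u(T₁), ψ(T₁)⟩`), on `(T₁, T₁ + S)` it is, after the change of variables
  `t ↦ t + T₁`, the weak formulation of `w` against the shifted test field `ψ(· + T₁)` with datum
  term `-⟨u(T₁), ψ(T₁)⟩`; the two boundary terms cancel. The energy inequality from `0` at times
  `t > T₁` is the sum of the inequality of `u` on `[0, T₁]` and of `w` on `[0, t - T₁]`; the
  energy inequalities from a.e. `s`, the weak gradient, the `L^∞(L²)` bound, weak continuity
  (at `T₁` from the right: weak continuity of `w` at its datum `u(T₁)`) and the strong attainment
  of `u₀` are glued likewise, transporting a.e. statements and integrals along `t ↦ t + T₁`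
  (`Literature.Analysis.FluidPDE.measurePreserving_timeShift_restrict`).
* *Continuation.* `u(T) ∈ L²` (every slice of a Leray–Hopf solution is in `L²`) and `u(T)` is
  weakly divergence free (a.e. slice is, and `t ↦ ∫ ⟪u(t), ∇θ⟫` is continuous on `(0, T]`);
  Leray's existence theorem gives a global Leray–Hopf solution `w` from `u(T)`, and for every
  `T' > 0` the concatenation restricted to `[0, T')` is Leray–Hopf
  (`Literature.Analysis.FluidPDE.IsLerayHopfOn.of_le`).

This is the classical remark that Leray–Hopf weak solutions can be continued globally by
restarting Leray's construction from the final state (Leray 1934, §31: the definition of a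
"solution turbulente" and the *Théorème d'existence* — to every square-summable initial state of
"quasi-divergence nulle" corresponds at least one solution turbulente defined for all later times,
Acta Math. 63, pp. 240–241; Robinson–Rodrigo–Sadowski 2016, §3.1 (3.1) and Def. 3.3 (ii) (the weak
formulation up to an intermediate time `s`, with the term `⟨u(s), φ(s)⟩`), Def. 4.9 (Leray–Hopf
weak solutions: the strong energy inequality for `s = 0` and almost all `s`) and Thm. 14.4
(existence on `ℝ³` of weak solutions satisfying the strong energy inequality, after Leray);
Albritton–Brué–Colombo 2022, after Thm. 1.2: "It is elementary to extend the distinct solutions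
to global-in-time Leray–Hopf solutions by modifying the force after `T` and using Leray's
result"). For the tree's `IsLerayHopfOn` (weak formulation tested on `(-∞, T) × E` with datum
term at `t = 0`, energy inequalities from `0` and from a.e. `s`, weak `L²`-continuity on `(0, T]`,
strong attainment of the datum) the gluing is a theorem and is proved here in full.

## References

* J. Leray, *Sur le mouvement d'un liquide visqueux emplissant l'espace*, Acta Math. 63 (1934),
  193–248, §31 (pp. 240–241). [Leray1934]
* J. C. Robinson, J. L. Rodrigo, W. Sadowski, *The three-dimensional Navier–Stokes equations.
  Classical theory* (CUP 2016), §3.1 (3.1), Def. 3.3, Def. 4.9, Thm. 14.4.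
  [RobinsonRodrigoSadowski2016]
* D. Albritton, E. Brué, M. Colombo, *Non-uniqueness of Leray solutions of the forced
  Navier–Stokes equations*, Ann. of Math. 196 (2022), 415–455, remark after Thm. 1.2
  (arXiv:2112.03116). [AlbrittonBrueColombo2022]
-/

noncomputable section

open MeasureTheory TopologicalSpace Set Function Filter Topology InnerProductSpace Metric
open scoped RealInnerProductSpace ENNReal NNReal Laplacian

namespace Literature.Analysis.FluidPDE

/-! ### Elementary lemmas: substitution `t ↦ T - t`, continuity across a junction -/

section Elementary

/-- Change of variables `t ↦ T - t` in a Bochner integral over `(0, T)`: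
`∫_{(0,T)} g(T - t) dt = ∫_{(0,T)} g`. [folklore] -/
private theorem setIntegral_Ioo_comp_sub_left {G : Type*} [NormedAddCommGroup G] [NormedSpace ℝ G]
    (g : ℝ → G) (T : ℝ) : ∫ t in Ioo 0 T, g (T - t) = ∫ t in Ioo 0 T, g t := by
  rcases le_or_gt T 0 with hT | hT
  · simp [Ioo_eq_empty_of_le hT]
  · calc ∫ t in Ioo 0 T, g (T - t) = ∫ t in Ioc 0 T, g (T - t) :=
          (integral_Ioc_eq_integral_Ioo (f := fun t => g (T - t))).symm
      _ = ∫ t in (0 : ℝ)..T, g (T - t) := (intervalIntegral.integral_of_le hT.le).symm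
      _ = ∫ t in (T - T)..(T - 0), g t := intervalIntegral.integral_comp_sub_left g T
      _ = ∫ t in (0 : ℝ)..T, g t := by rw [sub_self, sub_zero]
      _ = ∫ t in Ioc 0 T, g t := intervalIntegral.integral_of_le hT.le
      _ = ∫ t in Ioo 0 T, g t := integral_Ioc_eq_integral_Ioo

/-- Continuity on `(a, c]` from continuity on `(a, b]`, on `(b, c]` and right-continuity at the
junction `b`. [folklore] -/
private theorem continuousOn_Ioc_of_junction {Y : Type*} [TopologicalSpace Y] {F : ℝ → Y} {a b c : ℝ}
    (hab : a < b) (hbc : b ≤ c) (h₁ : ContinuousOn F (Ioc a b)) (h₂ : ContinuousOn F (Ioc b c))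
    (hb : ContinuousWithinAt F (Ioi b) b) : ContinuousOn F (Ioc a c) := by
  intro t ht
  have hunion : Ioc a c = Ioc a b ∪ Ioc b c := (Ioc_union_Ioc_eq_Ioc hab.le hbc).symm
  rw [hunion]
  rcases lt_trichotomy t b with htb | rfl | hbt
  · refine ContinuousWithinAt.union (h₁ t ⟨ht.1, htb.le⟩) ?_
    refine continuousWithinAt_of_notMem_closure fun h => ?_
    rcases eq_or_lt_of_le hbc with hbc' | hbc'
    · rw [hbc', Ioc_self, closure_empty] at h
      exact h
    · rw [closure_Ioc hbc'.ne] at h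
      exact absurd h.1 (not_le.2 htb)
  · refine ContinuousWithinAt.union (h₁ t ⟨hab, le_rfl⟩) ?_
    exact hb.mono Ioc_subset_Ioi_self
  · refine ContinuousWithinAt.union ?_ (h₂ t ⟨hbt, ht.2⟩)
    refine continuousWithinAt_of_notMem_closure fun h => ?_
    rw [closure_Ioc hab.ne] at h
    exact absurd h.2 (not_le.2 hbt)

end Elementary

/-! ### Final-time cut-off of a test field -/

section TestAlgebra

variable {X : Type*} [NormedAddCommGroup X] [NormedSpace ℝ X]
variable {F : Type*} [NormedAddCommGroup F] [NormedSpace ℝ F]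

/-- **Final-time cut-off of a test field.** If `ψ` is a space–time test field and `θ` is smooth
with `θ = 0` on `[T - a, ∞)` for some `a > 0`, then `θ(t) ψ(t, x)` is a test field on the slab
`(-∞, T) × X`. [folklore] -/
private theorem IsSpaceTimeTestOn.smul_cutoff_final {T a : ℝ} (ha : 0 < a) {Q : Opens (ℝ × X)}
    {ψ : ℝ → X → F} (hψ : IsSpaceTimeTestOn Q ψ) {θ : ℝ → ℝ} (hθ : ContDiff ℝ (⊤ : ℕ∞) θ)
    (hθ0 : ∀ s, T - a ≤ s → θ s = 0) :
    IsSpaceTimeTestOn (slab X (Iio T) isOpen_Iio) (fun s x => θ s • ψ s x) where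
  contDiff := (hθ.comp contDiff_fst).smul hψ.contDiff
  hasCompactSupport := by
    have : uncurry (fun s x => θ s • ψ s x) = fun z : ℝ × X => θ z.1 • uncurry ψ z := rfl
    rw [this]
    exact hψ.hasCompactSupport.smul_left
  tsupport_subset := by
    intro p hp
    have h2 : p.1 ∈ tsupport θ := by
      have h3 : p ∈ tsupport fun z : ℝ × X => θ z.1 :=
        tsupport_smul_subset_left (fun z : ℝ × X => θ z.1) (uncurry ψ) hp
      have h3' : (tsupport fun z : ℝ × X => θ z.1) ⊆ Prod.fst ⁻¹' tsupport θ :=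
        closure_minimal (fun z hz => subset_tsupport θ hz)
          ((isClosed_tsupport θ).preimage continuous_fst)
      exact h3' h3
    have h4 : tsupport θ ⊆ Iic (T - a) := by
      refine closure_minimal (fun s hs => ?_) isClosed_Iic
      by_contra h
      exact hs (hθ0 s (not_le.1 h).le)
    have h5 : p.1 ≤ T - a := h4 h2
    exact mem_slab.2 (show p.1 < T by linarith)

end TestAlgebra

/-! ### The weak formulation up to the final time -/

section Final

variable {E : Type*} [NormedAddCommGroup E] [InnerProductSpace ℝ E] [FiniteDimensional ℝ E]
  [MeasurableSpace E] [BorelSpace E]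
variable {T ν : ℝ} {u : ℝ → E → E} {u₀ : E → E}

/-- **The energy bound of an unforced Leray–Hopf solution**: `½‖u(t)‖² ≤ ½‖u₀‖²` for every
`t ∈ [0, T]` when `ν ≥ 0` (drop the dissipation in the energy inequality from `0`). [cite: RobinsonRodrigoSadowski2016, Def. 4.9] -/
theorem IsLerayHopfOn.kineticEnergy_le_of_zero_force (hLH : IsLerayHopfOn T ν 0 u₀ u)
    (hν : 0 ≤ ν) {t : ℝ} (ht : t ∈ Icc 0 T) :
    VectorCalculus.kineticEnergy (u t) ≤ VectorCalculus.kineticEnergy u₀ := by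
  obtain ⟨G, -, -, hEG, -⟩ := hLH.weakGrad_energy
  have h := hEG t ht
  have hforce : ∫ τ in (0 : ℝ)..t, ∫ x, ⟪(0 : ℝ → E → E) τ x, u τ x⟫ = 0 := by simp
  rw [hforce, add_zero] at h
  have hD : 0 ≤ ν * (∫⁻ τ in Ioo 0 t, ∫⁻ x, ENNReal.ofReal (frobeniusNormSq (G τ x))).toReal :=
    mul_nonneg hν ENNReal.toReal_nonneg
  linarith

/-- **Left-continuity of the pairing with a test field at the final time.** For an unforced
Leray–Hopf solution `u` on `[0, T)` (`ν ≥ 0`) and a space–time test field `ψ`,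
`⟨u(t), ψ(t)⟩ → ⟨u(T), ψ(T)⟩` as `t → T⁻`, quantitatively: for every `ε > 0` there is `τ > 0` with
`|⟨u(t), ψ(t)⟩ - ⟨u(T), ψ(T)⟩| ≤ ε` for all `t ∈ (T - τ, T)`. Split
`⟨u(t), ψ(t)⟩ - ⟨u(T), ψ(T)⟩ = ⟨u(t), ψ(t) - ψ(T)⟩ + (⟨u(t), ψ(T)⟩ - ⟨u(T), ψ(T)⟩)`: the second
term is small by the weak `L²`-continuity of `u` on `(0, T]`, the first is
`≤ ‖u(t)‖_{L¹(K)} sup |ψ(t) - ψ(T)|` with `‖u(t)‖_{L¹(K)} ≤ ½|K| + ½‖u(t)‖₂² ≤ ½|K| + ½‖u₀‖₂²` and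
`ψ` uniformly continuous. [folklore] -/
private theorem IsLerayHopfOn.exists_forall_abs_pairing_sub_final_le (hLH : IsLerayHopfOn T ν 0 u₀ u)
    (hν : 0 ≤ ν) (hT : 0 < T) {Q : Opens (ℝ × E)} {ψ : ℝ → E → E}
    (hψ : IsSpaceTimeTestOn Q ψ) {ε : ℝ} (hε : 0 < ε) :
    ∃ τ > 0, ∀ t ∈ Ioo (T - τ) T,
      |(∫ x, ⟪u t x, ψ t x⟫) - ∫ x, ⟪u T x, ψ T x⟫| ≤ ε := by
  -- the compact `x`-shadow of `ψ` and a sup bound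
  obtain ⟨K, hK, hKt⟩ := hψ.exists_compact_slice_subset
  have hψ0 : ∀ t x, x ∉ K → ψ t x = 0 := fun t x hx =>
    image_eq_zero_of_notMem_tsupport fun h' => hx (hKt t h')
  have cψ : Continuous (uncurry ψ) := hψ.contDiff.continuous
  have hψc_slice : ∀ s, Continuous (ψ s) := fun s => cψ.comp (Continuous.prodMk_right s)
  obtain ⟨Cψ, hCψ⟩ := cψ.bounded_above_of_compact_support hψ.hasCompactSupport
  set μK : Measure E := (volume : Measure E).restrict K with hμK
  haveI : IsFiniteMeasure μK :=
    ⟨by rw [hμK, Measure.restrict_apply_univ]; exact hK.measure_lt_top⟩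
  -- the uniform `L¹(K)` bound
  set M : ℝ := VectorCalculus.kineticEnergy u₀ with hM
  have hM0 : 0 ≤ M := kineticEnergy_nonneg _
  set I₁ : ℝ := 2⁻¹ * μK.real univ + M with hI₁
  have hI₁0 : 0 ≤ I₁ := by positivity
  have hL1 : ∀ t ∈ Icc 0 T, ∫ x, ‖u t x‖ ∂μK ≤ I₁ := by
    intro t ht
    have hm : MemLp (u t) 2 volume := hLH.memLp t ht
    have hsq : Integrable (fun x => ‖u t x‖ ^ 2) (volume : Measure E) :=
      hm.integrable_norm_pow two_ne_zero
    have hsqK : Integrable (fun x => ‖u t x‖ ^ 2) μK := hsq.restrict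
    have hiK : Integrable (u t) μK := (hm.restrict K).integrable one_le_two
    have hKE : ∫ x, ‖u t x‖ ^ 2 ∂μK ≤ 2 * VectorCalculus.kineticEnergy (u t) := by
      have h1 : ∫ x, ‖u t x‖ ^ 2 ∂μK ≤ ∫ x, ‖u t x‖ ^ 2 :=
        setIntegral_le_integral hsq (ae_of_all _ fun x => sq_nonneg _)
      rw [VectorCalculus.kineticEnergy]
      linarith
    calc ∫ x, ‖u t x‖ ∂μK ≤ ∫ x, (2⁻¹ + 2⁻¹ * ‖u t x‖ ^ 2) ∂μK := by
          refine integral_mono hiK.norm ((integrable_const _).add (hsqK.const_mul _)) fun x => ?_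
          dsimp only
          nlinarith [sq_nonneg (‖u t x‖ - 1)]
      _ = 2⁻¹ * μK.real univ + 2⁻¹ * ∫ x, ‖u t x‖ ^ 2 ∂μK := by
          rw [integral_add (integrable_const _) (hsqK.const_mul _), integral_const,
            integral_const_mul, smul_eq_mul, mul_comm]
      _ ≤ 2⁻¹ * μK.real univ + VectorCalculus.kineticEnergy (u t) := by linarith
      _ ≤ I₁ := by
          have := hLH.kineticEnergy_le_of_zero_force hν ht
          rw [hI₁]
          linarith
  -- weak continuity at `T` against the slice `ψ(T)`
  have hmemT : MemLp (ψ T) 2 (volume : Measure E) :=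
    (hψc_slice T).memLp_of_hasCompactSupport (hψ.hasCompactSupport_slice T)
  have hcwa : ContinuousWithinAt (fun t => ∫ x, ⟪u t x, ψ T x⟫) (Ioc 0 T) T :=
    (hLH.weak_continuous (ψ T) hmemT).1 T ⟨hT, le_rfl⟩
  obtain ⟨δ₁, hδ₁, hδ₁ψ⟩ := Metric.continuousWithinAt_iff.1 hcwa (ε / 2) (half_pos hε)
  -- uniform continuity of `ψ`
  set ε₁ : ℝ := ε / (2 * (I₁ + 1)) with hε₁
  have hε₁0 : 0 < ε₁ := by positivity
  obtain ⟨d, hd, hdψ⟩ : ∃ d > 0, ∀ t x, |t - T| < d → ‖ψ t x - ψ T x‖ ≤ ε₁ := by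
    have huc := hψ.hasCompactSupport.uniformContinuous_of_continuous cψ
    obtain ⟨d, hd, h⟩ := Metric.uniformContinuous_iff.1 huc ε₁ hε₁0
    refine ⟨d, hd, fun t x ht => ?_⟩
    have hdist : dist (t, x) (T, x) < d := by
      rw [Prod.dist_eq, dist_self, Real.dist_eq, max_eq_left (abs_nonneg _)]
      exact ht
    have := h hdist
    rw [dist_eq_norm] at this
    exact this.le
  -- the final `τ`
  refine ⟨min (min δ₁ d) T, lt_min (lt_min hδ₁ hd) hT, fun t ht => ?_⟩
  have hτ₁ : min (min δ₁ d) T ≤ δ₁ := (min_le_left _ _).trans (min_le_left _ _)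
  have hτ₂ : min (min δ₁ d) T ≤ d := (min_le_left _ _).trans (min_le_right _ _)
  have hτ₃ : min (min δ₁ d) T ≤ T := min_le_right _ _
  have htT : t < T := ht.2
  have ht0 : 0 < t := by linarith [ht.1]
  have htI : t ∈ Icc 0 T := ⟨ht0.le, htT.le⟩
  have habs : |t - T| = T - t := by
    rw [abs_sub_comm]
    exact abs_of_pos (by linarith)
  have htδ₁ : dist t T < δ₁ := by
    rw [Real.dist_eq, habs]
    linarith [ht.1]
  have htd : |t - T| < d := by
    rw [habs]
    linarith [ht.1]
  -- the weakly continuous term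
  have h1 : |(∫ x, ⟪u t x, ψ T x⟫) - ∫ x, ⟪u T x, ψ T x⟫| < ε / 2 := by
    have := hδ₁ψ ⟨ht0, htT.le⟩ htδ₁
    rwa [Real.dist_eq] at this
  -- the uniformly continuous term
  have hm : MemLp (u t) 2 volume := hLH.memLp t htI
  have hiK : Integrable (u t) μK := (hm.restrict K).integrable one_le_two
  have hred : ∀ φ : E → E, (∀ x, x ∉ K → φ x = 0) →
      ∫ x, ⟪u t x, φ x⟫ = ∫ x, ⟪u t x, φ x⟫ ∂μK := by
    intro φ hφ
    rw [hμK]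
    exact (setIntegral_eq_integral_of_forall_compl_eq_zero fun x hx => by
      rw [hφ x hx, inner_zero_right]).symm
  have hint : ∀ s, Integrable (fun x => ⟪u t x, ψ s x⟫) μK := by
    intro s
    refine Integrable.mono' (hiK.norm.mul_const Cψ)
      (hiK.1.inner (hψc_slice s).aestronglyMeasurable) ?_
    filter_upwards with x
    exact (norm_inner_le_norm _ _).trans
      (mul_le_mul_of_nonneg_left (hCψ (s, x)) (norm_nonneg _))
  have h2 : |(∫ x, ⟪u t x, ψ t x⟫) - ∫ x, ⟪u t x, ψ T x⟫| ≤ ε / 2 := by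
    rw [hred (ψ t) (hψ0 t), hred (ψ T) (hψ0 T), ← integral_sub (hint t) (hint T)]
    have hb : ∀ᵐ x ∂μK, ‖⟪u t x, ψ t x⟫ - ⟪u t x, ψ T x⟫‖ ≤ ‖u t x‖ * ε₁ := by
      filter_upwards with x
      rw [← inner_sub_right]
      exact (norm_inner_le_norm _ _).trans
        (mul_le_mul_of_nonneg_left (hdψ t x htd) (norm_nonneg _))
    have hne : I₁ + 1 ≠ 0 := by linarith
    have hfrac : I₁ / (I₁ + 1) ≤ 1 := (div_le_one (by linarith)).2 (by linarith)
    calc |∫ x, (⟪u t x, ψ t x⟫ - ⟪u t x, ψ T x⟫) ∂μK| ≤ ∫ x, ‖u t x‖ * ε₁ ∂μK := by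
          rw [← Real.norm_eq_abs]
          exact norm_integral_le_of_norm_le (hiK.norm.mul_const _) hb
      _ = (∫ x, ‖u t x‖ ∂μK) * ε₁ := by rw [integral_mul_const]
      _ ≤ I₁ * ε₁ := mul_le_mul_of_nonneg_right (hL1 t htI) hε₁0.le
      _ = ε / 2 * (I₁ / (I₁ + 1)) := by rw [hε₁]; field_simp
      _ ≤ ε / 2 * 1 := by gcongr
      _ = ε / 2 := mul_one _
  have hsplit : (∫ x, ⟪u t x, ψ t x⟫) - ∫ x, ⟪u T x, ψ T x⟫ =
      ((∫ x, ⟪u t x, ψ t x⟫) - ∫ x, ⟪u t x, ψ T x⟫) +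
        ((∫ x, ⟪u t x, ψ T x⟫) - ∫ x, ⟪u T x, ψ T x⟫) := by ring
  rw [hsplit]
  calc |((∫ x, ⟪u t x, ψ t x⟫) - ∫ x, ⟪u t x, ψ T x⟫) +
        ((∫ x, ⟪u t x, ψ T x⟫) - ∫ x, ⟪u T x, ψ T x⟫)|
      ≤ |(∫ x, ⟪u t x, ψ t x⟫) - ∫ x, ⟪u t x, ψ T x⟫| +
        |(∫ x, ⟪u t x, ψ T x⟫) - ∫ x, ⟪u T x, ψ T x⟫| := abs_add_le _ _
    _ ≤ ε / 2 + ε / 2 := add_le_add h2 h1.le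
    _ = ε := add_halves ε

/-- **The weak formulation up to the final time.** Let `u` be a Leray–Hopf weak solution of the
unforced Navier–Stokes system on `E × [0, T)` with datum `u₀` (`ν ≥ 0`, `T > 0`). For every
space–time test field `ψ` with divergence-free slices — *not* required to vanish near `t = T` —
`∫₀ᵀ ∫ (⟪u, ∂ₜψ⟫ + ⟪u, (u·∇)ψ⟫ + ν ⟪u, Δψ⟫) + ∫ ⟪u₀, ψ(0)⟫ = ∫ ⟪u(T), ψ(T)⟫`.
Test with the cut-offs `η_δ(T - t) ψ(t, x)` (test fields on `(-∞, T) × E` with divergence-free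
slices) and let `δ → 0`: `∫∫ η_δ(T - ·) Φ → ∫∫ Φ` by dominated convergence and
`∫ η_δ'(T - t) ⟨u(t), ψ(t)⟩ dt → ⟨u(T), ψ(T)⟩` by the left-continuity of the pairing at `T`
(`IsLerayHopfOn.exists_forall_abs_pairing_sub_final_le`) — the time-reflected form of the cut-off
argument of Robinson–Rodrigo–Sadowski 2016, §3.1 (derivation of (3.1), PDF p. 58), cf. their
Def. 3.3 (ii) (the weak formulation between intermediate times). [cite: RobinsonRodrigoSadowski2016, §3.1 p. 58 (3.1) and Def. 3.3 (ii)] -/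
theorem IsLerayHopfOn.weakIdentity_final (hLH : IsLerayHopfOn T ν 0 u₀ u) (hν : 0 ≤ ν)
    (hT : 0 < T) {Q : Opens (ℝ × E)} {ψ : ℝ → E → E} (hψ : IsSpaceTimeTestOn Q ψ)
    (hdiv : ∀ t, VectorCalculus.IsDivFree (ψ t)) :
    (∫ t in Ioo 0 T, ∫ x, (⟪u t x, timeDeriv ψ t x⟫ + ⟪u t x, convect (u t) (ψ t) x⟫ +
        ν * ⟪u t x, Δ (ψ t) x⟫ + ⟪(0 : ℝ → E → E) t x, ψ t x⟫)) + ∫ x, ⟪u₀ x, ψ 0 x⟫ =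
      ∫ x, ⟪u T x, ψ T x⟫ := by
  obtain ⟨hmeas, hL2, -, hweak⟩ := hLH.weak
  -- the compact `x`-shadow of `ψ`
  obtain ⟨K, hK, hKt⟩ := hψ.exists_compact_slice_subset
  have hψ0 : ∀ t x, x ∉ K → ψ t x = 0 := fun t x hx =>
    image_eq_zero_of_notMem_tsupport fun h' => hx (hKt t h')
  -- regularity of the test-field ingredients as functions on `ℝ × E`
  have cψ : Continuous (uncurry ψ) := hψ.contDiff.continuous
  have cψ' : Continuous (uncurry (timeDeriv ψ)) := hψ.continuous_timeDeriv
  have cD : Continuous fun z : ℝ × E => fderiv ℝ (ψ z.1) z.2 := by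
    have h := ((hψ.isSmoothSpaceTimeOn univ).fderiv_slice uniqueDiffOn_univ).continuousOn
    rw [univ_prod_univ, continuousOn_univ] at h
    exact h
  have cL : Continuous fun z : ℝ × E => Δ (ψ z.1) z.2 := by
    have h := ((hψ.isSmoothSpaceTimeOn univ).laplacian uniqueDiffOn_univ).continuousOn
    rw [univ_prod_univ, continuousOn_univ] at h
    exact h
  have hψd : ∀ t, Differentiable ℝ (ψ t) := fun t =>
    (hψ.contDiff_slice t).differentiable (by simp)
  have hψ2 : ∀ t, ContDiff ℝ 2 (ψ t) := fun t => contDiff_infty.1 (hψ.contDiff_slice t) 2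
  have hD0 : ∀ t x, x ∉ K → fderiv ℝ (ψ t) x = 0 := fun t x hx =>
    fderiv_of_notMem_tsupport ℝ fun h => hx (hKt t h)
  have hL0 : ∀ t x, x ∉ K → Δ (ψ t) x = 0 := fun t x hx =>
    laplacian_eq_zero_of_notMem_tsupport fun h => hx (hKt t h)
  have hψ'0 : ∀ t x, x ∉ K → timeDeriv ψ t x = 0 := fun t x hx =>
    timeDeriv_eq_zero_of_forall (fun s => hψ0 s x hx) t
  -- integrability on the slab
  obtain ⟨hUK1, hUK2⟩ := integrableOn_cylinder_of_lintegral_sq_slab hmeas hL2 hK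
  have iA : Integrable (fun z : ℝ × E => ⟪u z.1 z.2, timeDeriv ψ z.1 z.2⟫)
      (((volume : Measure ℝ).restrict (Ioo 0 T)).prod (volume : Measure E)) :=
    integrable_slab_inner hK hUK1 cψ' hψ'0
  have iB : Integrable (fun z : ℝ × E => ⟪u z.1 z.2, convect (u z.1) (ψ z.1) z.2⟫)
      (((volume : Measure ℝ).restrict (Ioo 0 T)).prod (volume : Measure E)) :=
    integrable_slab_inner_clm_apply hK hUK1 hUK2 cD hD0
  have iC : Integrable (fun z : ℝ × E => ⟪u z.1 z.2, Δ (ψ z.1) z.2⟫)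
      (((volume : Measure ℝ).restrict (Ioo 0 T)).prod (volume : Measure E)) :=
    integrable_slab_inner hK hUK1 cL hL0
  have iF : Integrable (fun z : ℝ × E => ⟪(0 : ℝ → E → E) z.1 z.2, ψ z.1 z.2⟫)
      (((volume : Measure ℝ).restrict (Ioo 0 T)).prod (volume : Measure E)) := by
    simp only [Pi.zero_apply, inner_zero_left]
    exact integrable_zero _ _ _
  have iU : Integrable (fun z : ℝ × E => ⟪u z.1 z.2, ψ z.1 z.2⟫)
      (((volume : Measure ℝ).restrict (Ioo 0 T)).prod (volume : Measure E)) :=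
    integrable_slab_inner hK hUK1 cψ hψ0
  set Φ : ℝ × E → ℝ := fun z => ⟪u z.1 z.2, timeDeriv ψ z.1 z.2⟫ +
    ⟪u z.1 z.2, convect (u z.1) (ψ z.1) z.2⟫ + ν * ⟪u z.1 z.2, Δ (ψ z.1) z.2⟫ +
    ⟪(0 : ℝ → E → E) z.1 z.2, ψ z.1 z.2⟫ with hΦ
  have iΦ : Integrable Φ (((volume : Measure ℝ).restrict (Ioo 0 T)).prod (volume : Measure E)) :=
    ((iA.add iB).add (iC.const_mul ν)).add iF
  -- the pairing `U(t) = ⟨u(t), ψ(t)⟩`, its reflection and its limit at `T⁻`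
  set U : ℝ → ℝ := fun t => ∫ x, ⟪u t x, ψ t x⟫ with hU_def
  set L : ℝ := ∫ x, ⟪u T x, ψ T x⟫ with hL_def
  have hUint : IntegrableOn U (Ioo 0 T) := iU.integral_prod_left
  have hU'int : IntegrableOn (fun t => U (T - t)) (Ioo 0 T) := by
    have h1 : IntervalIntegrable U volume 0 T :=
      (intervalIntegrable_iff_integrableOn_Ioo_of_le hT.le).2 hUint
    have h2 : IntervalIntegrable (fun t => U (T - t)) volume (T - 0) (T - T) := h1.comp_sub_left T
    rw [sub_zero, sub_self] at h2
    exact (intervalIntegrable_iff_integrableOn_Ioo_of_le hT.le).1 h2.symm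
  have hlim : ∀ ε > 0, ∃ τ > 0, ∀ᵐ t ∂((volume : Measure ℝ).restrict (Ioo 0 τ)),
      |U (T - t) - L| ≤ ε := by
    intro ε hε
    obtain ⟨τ, hτ, h⟩ := hLH.exists_forall_abs_pairing_sub_final_le hν hT hψ hε
    refine ⟨τ, hτ, ?_⟩
    filter_upwards [ae_restrict_mem measurableSet_Ioo] with t ht
    exact h (T - t) ⟨by linarith [ht.2], by linarith [ht.1]⟩
  -- the cut-offs `η k` with derivatives `ρ k`, at scale `δ k = T / (6 (k + 1))`
  set δ : ℕ → ℝ := fun k => T / (6 * ((k : ℝ) + 1)) with hδ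
  have hδ0 : ∀ k, 0 < δ k := fun k => by positivity
  have hδT : ∀ k, 3 * δ k ≤ T := fun k => by
    have hk : (0 : ℝ) ≤ k := Nat.cast_nonneg k
    have h1 : δ k ≤ T / 6 := by
      show T / (6 * ((k : ℝ) + 1)) ≤ T / 6
      exact div_le_div_of_nonneg_left hT.le (by norm_num) (by nlinarith)
    linarith
  have hδlim : Tendsto δ atTop (𝓝 0) := by
    have h1 : Tendsto (fun k : ℕ => (k : ℝ) + 1) atTop atTop :=
      tendsto_atTop_add_const_right _ 1 tendsto_natCast_atTop_atTop
    have h2 : Tendsto (fun k : ℕ => 6 * ((k : ℝ) + 1)) atTop atTop :=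
      h1.const_mul_atTop (by norm_num)
    exact tendsto_const_nhds.div_atTop h2
  obtain hcut : ∀ k, ∃ η ρ : ℝ → ℝ, ContDiff ℝ (⊤ : ℕ∞) η ∧ Continuous ρ ∧
      (∀ s, HasDerivAt η (ρ s) s) ∧ (∀ s, s ≤ δ k → η s = 0) ∧ (∀ s, 3 * δ k ≤ s → η s = 1) ∧
      (∀ s, η s ∈ Icc (0 : ℝ) 1) ∧ (∀ s, 0 ≤ ρ s) ∧ (∀ s, s ∉ Ioo (δ k) (3 * δ k) → ρ s = 0) ∧
      ∫ s, ρ s = 1 := fun k => exists_smooth_time_cutoff (hδ0 k)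
  choose η ρ hηs hρc hηρ hη0 hη1 hη01 hρ0 hρsupp hρ1 using hcut
  have hηabs : ∀ k s, |η k s| ≤ 1 := fun k s => by
    rw [abs_le]
    exact ⟨by linarith [(hη01 k s).1], (hη01 k s).2⟩
  have hρC : ∀ k, ∃ C, 0 ≤ C ∧ ∀ s, |ρ k s| ≤ C := fun k =>
    exists_abs_le_of_eq_zero_off_Ioo (hρc k) (hρsupp k)
  -- the reflected cut-offs `θ k t = η k (T - t)` with derivatives `-ρ k (T - t)`
  have hθs : ∀ k, ContDiff ℝ (⊤ : ℕ∞) fun s => η k (T - s) := fun k =>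
    (hηs k).comp (contDiff_const.sub contDiff_id)
  have hθρ : ∀ k s, HasDerivAt (fun s => η k (T - s)) (-ρ k (T - s)) s := fun k s => by
    have h := (hηρ k (T - s)).comp s ((hasDerivAt_id s).const_sub T)
    exact h.congr_deriv (by ring)
  have hθ0 : ∀ k s, T - δ k ≤ s → η k (T - s) = 0 := fun k s hs => hη0 k (T - s) (by linarith)
  have hθT : ∀ k, η k (T - 0) = 1 := fun k => by
    rw [sub_zero]
    exact hη1 k T (hδT k)
  -- Step 1: the tested identity for each `k`
  have hAB : ∀ k, (∫ z, η k (T - z.1) * Φ z ∂(((volume : Measure ℝ).restrict (Ioo 0 T)).prod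
      (volume : Measure E))) + (∫ t in Ioo 0 T, (-ρ k (T - t)) * U t) +
      ∫ x, ⟪u₀ x, ψ 0 x⟫ = 0 := by
    intro k
    obtain ⟨C, -, hC⟩ := hρC k
    have hψk : IsSpaceTimeTestOn (slab E (Iio T) isOpen_Iio) (fun s x => η k (T - s) • ψ s x) :=
      hψ.smul_cutoff_final (hδ0 k) (hθs k) (hθ0 k)
    have hdivk : ∀ t, VectorCalculus.IsDivFree (fun x => η k (T - t) • ψ t x) := fun t =>
      isDivFree_const_smul (hdiv t) (hψd t) (η k (T - t))
    have key := hweak _ hψk hdivk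
    have iρU : Integrable (fun z : ℝ × E => (-ρ k (T - z.1)) * ⟪u z.1 z.2, ψ z.1 z.2⟫)
        (((volume : Measure ℝ).restrict (Ioo 0 T)).prod (volume : Measure E)) := by
      refine integrable_time_mul iU (η := fun s => -ρ k (T - s))
        ((hρc k).comp (continuous_const.sub continuous_id)).neg (C := C) fun s => ?_
      rw [abs_neg]
      exact hC (T - s)
    have iηΦ : Integrable (fun z : ℝ × E => η k (T - z.1) * Φ z)
        (((volume : Measure ℝ).restrict (Ioo 0 T)).prod (volume : Measure E)) :=
      integrable_time_mul iΦ (η := fun s => η k (T - s)) (hθs k).continuous fun s =>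
        hηabs k (T - s)
    have key' : (∫ t in Ioo 0 T, ∫ x, ((-ρ k (T - t)) * ⟪u t x, ψ t x⟫ +
        η k (T - t) * Φ (t, x))) + ∫ x, ⟪u₀ x, ψ 0 x⟫ = 0 := by
      simp only [hθT k, one_smul] at key
      refine Eq.trans ?_ key
      congr 1
      refine setIntegral_congr_fun measurableSet_Ioo fun t _ => ?_
      refine integral_congr_ae (ae_of_all _ fun x => ?_)
      rw [hΦ]
      dsimp only
      rw [timeDeriv_cutoff (hθρ k) hψ.hasDerivAt_time, convect_fun_const_smul _ (hψd t x),
        laplacian_fun_const_smul (hψ2 t)]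
      simp only [inner_add_right, real_inner_smul_right, Pi.zero_apply, inner_zero_left]
      ring
    have hprod : ∫ t in Ioo 0 T, ∫ x, ((-ρ k (T - t)) * ⟪u t x, ψ t x⟫ + η k (T - t) * Φ (t, x)) =
        ∫ z, ((-ρ k (T - z.1)) * ⟪u z.1 z.2, ψ z.1 z.2⟫ + η k (T - z.1) * Φ z)
          ∂(((volume : Measure ℝ).restrict (Ioo 0 T)).prod (volume : Measure E)) :=
      (integral_prod _ (iρU.add iηΦ)).symm
    rw [hprod, integral_add iρU iηΦ, integral_prod _ iρU] at key'
    simp only [integral_const_mul] at key'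
    linarith
  -- Step 2: the limits `k → ∞`
  have hA : Tendsto (fun k => ∫ z, η k (T - z.1) * Φ z ∂(((volume : Measure ℝ).restrict
      (Ioo 0 T)).prod (volume : Measure E))) atTop
      (𝓝 (∫ z, Φ z ∂(((volume : Measure ℝ).restrict (Ioo 0 T)).prod (volume : Measure E)))) := by
    refine tendsto_integral_of_dominated_convergence (fun z => ‖Φ z‖)
      (fun k => (integrable_time_mul iΦ (η := fun s => η k (T - s)) (hθs k).continuous
        fun s => hηabs k (T - s)).aestronglyMeasurable)
      iΦ.norm (fun k => Eventually.of_forall fun z => ?_) ?_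
    · rw [norm_mul, Real.norm_eq_abs]
      exact mul_le_of_le_one_left (norm_nonneg _) (hηabs k (T - z.1))
    · have hmem : ∀ᵐ z ∂(((volume : Measure ℝ).restrict (Ioo 0 T)).prod (volume : Measure E)),
          z ∈ Ioo 0 T ×ˢ (univ : Set E) := by
        rw [← volume_restrict_slab_eq]
        exact ae_restrict_mem (measurableSet_Ioo.prod MeasurableSet.univ)
      filter_upwards [hmem] with z hz
      have hz1 : 0 < T - z.1 := by linarith [hz.1.2]
      have h3 : Tendsto (fun k => 3 * δ k) atTop (𝓝 0) := by
        simpa using hδlim.const_mul 3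
      have hev : ∀ᶠ k in atTop, 3 * δ k < T - z.1 := (tendsto_order.1 h3).2 _ hz1
      refine (tendsto_const_nhds (x := Φ z)).congr' ?_
      filter_upwards [hev] with k hk
      rw [hη1 k (T - z.1) hk.le, one_mul]
  have hB : Tendsto (fun k => ∫ t in Ioo 0 T, (-ρ k (T - t)) * U t) atTop (𝓝 (-L)) := by
    have h1 : Tendsto (fun k => ∫ t in Ioo 0 T, ρ k t * U (T - t)) atTop (𝓝 L) :=
      tendsto_setIntegral_mul_of_ae_tendsto hU'int hlim hδlim hδ0 hδT hρc hρ0 hρsupp hρ1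
    have h2 : ∀ k, ∫ t in Ioo 0 T, (-ρ k (T - t)) * U t =
        -∫ t in Ioo 0 T, ρ k t * U (T - t) := by
      intro k
      rw [← setIntegral_Ioo_comp_sub_left (fun t => ρ k t * U (T - t)) T, ← integral_neg]
      refine setIntegral_congr_fun measurableSet_Ioo fun t _ => ?_
      simp only [sub_sub_cancel, neg_mul]
    exact h1.neg.congr fun k => (h2 k).symm
  have hsum : (∫ z, Φ z ∂(((volume : Measure ℝ).restrict (Ioo 0 T)).prod (volume : Measure E))) +
      -L + ∫ x, ⟪u₀ x, ψ 0 x⟫ = 0 :=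
    tendsto_nhds_unique ((hA.add hB).add tendsto_const_nhds)
      (tendsto_const_nhds.congr fun k => (hAB k).symm)
  rw [integral_prod _ iΦ] at hsum
  rw [hL_def] at hsum
  linarith

end Final

/-! ### Gluing lemmas on the time axis -/

section TimeGlue

/-- An a.e. statement on `(a, c)` from the a.e. statements on `(a, b)` and on `(b, c)` (the
junction `{b}` is Lebesgue-null). [folklore] -/
private theorem ae_restrict_Ioo_of_Ioo_of_Ioo {P : ℝ → Prop} {a b c : ℝ}
    (h₁ : ∀ᵐ t ∂((volume : Measure ℝ).restrict (Ioo a b)), P t)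
    (h₂ : ∀ᵐ t ∂((volume : Measure ℝ).restrict (Ioo b c)), P t) :
    ∀ᵐ t ∂((volume : Measure ℝ).restrict (Ioo a c)), P t := by
  have hsub : Ioo a c ⊆ Ioc a b ∪ Ioo b c := by
    intro t ht
    rcases le_or_gt t b with h | h
    · exact Or.inl ⟨ht.1, h⟩
    · exact Or.inr ⟨h, ht.2⟩
  have h₁' : ∀ᵐ t ∂((volume : Measure ℝ).restrict (Ioc a b)), P t := by
    rwa [← Measure.restrict_congr_set (Ioo_ae_eq_Ioc (μ := (volume : Measure ℝ)))]
  exact ae_restrict_of_ae_restrict_of_subset hsub ((ae_restrict_union_iff _ _ _).2 ⟨h₁', h₂⟩)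

/-- Transport of an a.e. statement on `(a, b)` along `t ↦ t - s` to `(a + s, b + s)`.
[folklore] -/
private theorem ae_restrict_Ioo_sub_transport {a b : ℝ} (s : ℝ) {P : ℝ → Prop}
    (h : ∀ᵐ t ∂((volume : Measure ℝ).restrict (Ioo a b)), P t) :
    ∀ᵐ t ∂((volume : Measure ℝ).restrict (Ioo (a + s) (b + s))), P (t - s) := by
  have h' : ∀ᵐ t ∂((volume : Measure ℝ).restrict (Ioo (a + s + -s) (b + s + -s))), P t := by
    rwa [add_neg_cancel_right, add_neg_cancel_right]
  have := ae_restrict_Ioo_comp_add_right (-s) h'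
  simpa only [← sub_eq_add_neg] using this

/-- Splitting a lower integral over `(a, c)` at an interior point `b`. [folklore] -/
private theorem setLIntegral_Ioo_split (g : ℝ → ℝ≥0∞) {a b c : ℝ} (hab : a < b) (hbc : b ≤ c) :
    ∫⁻ t in Ioo a c, g t = (∫⁻ t in Ioo a b, g t) + ∫⁻ t in Ioo b c, g t := by
  rw [← Ioo_union_Ico_eq_Ioo hab hbc, lintegral_union measurableSet_Ico
    (disjoint_left.2 fun t h1 h2 => (not_le.2 h1.2) h2.1),
    setLIntegral_congr (Ioo_ae_eq_Ico (μ := (volume : Measure ℝ))).symm]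

end TimeGlue

/-! ### Time shift of test fields (forward) and integrability of the tested integrand -/

section ShiftTest

variable {E : Type*} [NormedAddCommGroup E] [InnerProductSpace ℝ E] [FiniteDimensional ℝ E]
  [MeasurableSpace E] [BorelSpace E]
variable {F' : Type*} [NormedAddCommGroup F'] [NormedSpace ℝ F']

omit [MeasurableSpace E] [BorelSpace E] [FiniteDimensional ℝ E] in
/-- **Forward time shift of a test field.** If `ψ` is a test field on the slab `(-∞, T) × E`, then
`(t, x) ↦ ψ(t + s, x)` is a test field on `(-∞, T - s) × E`. [folklore] -/
private theorem IsSpaceTimeTestOn.comp_add_time_Iio {T s : ℝ} {ψ : ℝ → E → F'}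
    (hψ : IsSpaceTimeTestOn (slab E (Iio T) isOpen_Iio) ψ) :
    IsSpaceTimeTestOn (slab E (Iio (T - s)) isOpen_Iio) (fun t x => ψ (t + s) x) := by
  set θ : ℝ × E ≃ₜ ℝ × E := (Homeomorph.addRight s).prodCongr (Homeomorph.refl E) with hθ
  have hθap : ∀ z : ℝ × E, θ z = (z.1 + s, z.2) := fun z => by
    obtain ⟨t, x⟩ := z
    simp [hθ]
  have hfun : (uncurry fun t x => ψ (t + s) x) = uncurry ψ ∘ θ := by
    funext z
    simp only [comp_apply, hθap, uncurry]
  have hsupp : tsupport (uncurry ψ ∘ θ) = θ ⁻¹' tsupport (uncurry ψ) := by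
    rw [tsupport, tsupport, support_comp_eq_preimage, θ.preimage_closure]
  refine ⟨?_, ?_, ?_⟩
  · exact hψ.contDiff.comp ((contDiff_fst.add contDiff_const).prodMk contDiff_snd)
  · rw [hfun]
    exact hψ.hasCompactSupport.comp_homeomorph θ
  · rw [hfun, hsupp]
    intro z hz
    have h1 : θ z ∈ (slab E (Iio T) isOpen_Iio : Set (ℝ × E)) := hψ.tsupport_subset hz
    have h2 : z.1 + s < T := by
      have := mem_slab.1 h1
      rwa [hθap] at this
    exact mem_slab.2 (show z.1 < T - s by linarith)

omit [NormedAddCommGroup E] [InnerProductSpace ℝ E] [MeasurableSpace E] [BorelSpace E]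
  [FiniteDimensional ℝ E] in
/-- The time derivative commutes with the forward time shift of a test field. [folklore] -/
private theorem timeDeriv_comp_add_time_apply (ψ : ℝ → E → F') (s t : ℝ) (x : E) :
    timeDeriv (fun τ y => ψ (τ + s) y) t x = timeDeriv ψ (t + s) x := by
  simp only [timeDeriv_apply]
  exact deriv_comp_add_const (fun τ => ψ τ x) s t

variable {T : ℝ} {u : ℝ → E → E}

/-- **The tested integrand is integrable in time.** If `u` is measurable on the slab `(0, T) × E`
and locally square integrable there, then for every space–time test field `ψ` the function
`t ↦ ∫ (⟪u, ∂ₜψ⟫ + ⟪u, (u·∇)ψ⟫ + ν ⟪u, Δψ⟫ + ⟪0, ψ⟫)` is integrable on `(0, T)` (Fubini on the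
finite cylinder `(0, T) × K`). [folklore] -/
private theorem integrableOn_testedIntegrand
    (hmeas : AEStronglyMeasurable (uncurry u) ((volume : Measure (ℝ × E)).restrict (Ioo 0 T ×ˢ univ)))
    (hL2 : ∀ K : Set E, IsCompact K → ∫⁻ z in Ioo 0 T ×ˢ K, ‖uncurry u z‖ₑ ^ 2 < ∞)
    {Q : Opens (ℝ × E)} {ψ : ℝ → E → E} (hψ : IsSpaceTimeTestOn Q ψ) (ν : ℝ) :
    IntegrableOn (fun t => ∫ x, (⟪u t x, timeDeriv ψ t x⟫ + ⟪u t x, convect (u t) (ψ t) x⟫ +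
        ν * ⟪u t x, Δ (ψ t) x⟫ + ⟪(0 : ℝ → E → E) t x, ψ t x⟫)) (Ioo 0 T) := by
  obtain ⟨K, hK, hKt⟩ := hψ.exists_compact_slice_subset
  have hψ0 : ∀ t x, x ∉ K → ψ t x = 0 := fun t x hx =>
    image_eq_zero_of_notMem_tsupport fun h' => hx (hKt t h')
  have cψ' : Continuous (uncurry (timeDeriv ψ)) := hψ.continuous_timeDeriv
  have cD : Continuous fun z : ℝ × E => fderiv ℝ (ψ z.1) z.2 := by
    have h := ((hψ.isSmoothSpaceTimeOn univ).fderiv_slice uniqueDiffOn_univ).continuousOn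
    rw [univ_prod_univ, continuousOn_univ] at h
    exact h
  have cL : Continuous fun z : ℝ × E => Δ (ψ z.1) z.2 := by
    have h := ((hψ.isSmoothSpaceTimeOn univ).laplacian uniqueDiffOn_univ).continuousOn
    rw [univ_prod_univ, continuousOn_univ] at h
    exact h
  have hD0 : ∀ t x, x ∉ K → fderiv ℝ (ψ t) x = 0 := fun t x hx =>
    fderiv_of_notMem_tsupport ℝ fun h => hx (hKt t h)
  have hL0 : ∀ t x, x ∉ K → Δ (ψ t) x = 0 := fun t x hx =>
    laplacian_eq_zero_of_notMem_tsupport fun h => hx (hKt t h)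
  have hψ'0 : ∀ t x, x ∉ K → timeDeriv ψ t x = 0 := fun t x hx =>
    timeDeriv_eq_zero_of_forall (fun s => hψ0 s x hx) t
  obtain ⟨hUK1, hUK2⟩ := integrableOn_cylinder_of_lintegral_sq_slab hmeas hL2 hK
  have iA : Integrable (fun z : ℝ × E => ⟪u z.1 z.2, timeDeriv ψ z.1 z.2⟫)
      (((volume : Measure ℝ).restrict (Ioo 0 T)).prod (volume : Measure E)) :=
    integrable_slab_inner hK hUK1 cψ' hψ'0
  have iB : Integrable (fun z : ℝ × E => ⟪u z.1 z.2, convect (u z.1) (ψ z.1) z.2⟫)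
      (((volume : Measure ℝ).restrict (Ioo 0 T)).prod (volume : Measure E)) :=
    integrable_slab_inner_clm_apply hK hUK1 hUK2 cD hD0
  have iC : Integrable (fun z : ℝ × E => ⟪u z.1 z.2, Δ (ψ z.1) z.2⟫)
      (((volume : Measure ℝ).restrict (Ioo 0 T)).prod (volume : Measure E)) :=
    integrable_slab_inner hK hUK1 cL hL0
  have iF : Integrable (fun z : ℝ × E => ⟪(0 : ℝ → E → E) z.1 z.2, ψ z.1 z.2⟫)
      (((volume : Measure ℝ).restrict (Ioo 0 T)).prod (volume : Measure E)) := by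
    simp only [Pi.zero_apply, inner_zero_left]
    exact integrable_zero _ _ _
  have iΦ : Integrable (fun z : ℝ × E => ⟪u z.1 z.2, timeDeriv ψ z.1 z.2⟫ +
      ⟪u z.1 z.2, convect (u z.1) (ψ z.1) z.2⟫ + ν * ⟪u z.1 z.2, Δ (ψ z.1) z.2⟫ +
      ⟪(0 : ℝ → E → E) z.1 z.2, ψ z.1 z.2⟫)
      (((volume : Measure ℝ).restrict (Ioo 0 T)).prod (volume : Measure E)) :=
    ((iA.add iB).add (iC.const_mul ν)).add iF
  exact iΦ.integral_prod_left

end ShiftTest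

/-! ### Concatenation: the weak formulation -/

section ConcatWeak

variable {E : Type*} [NormedAddCommGroup E] [InnerProductSpace ℝ E] [FiniteDimensional ℝ E]
  [MeasurableSpace E] [BorelSpace E]
variable {T₁ S ν : ℝ} {u w : ℝ → E → E} {u₀ : E → E}

/-- **The glued field is a weak solution.** Let `u` be a Leray–Hopf weak solution of the unforced
system on `[0, T₁)` from `u₀` (`ν ≥ 0`) and `w` a Leray–Hopf weak solution on `[0, S)` from the
final slice `u(T₁)`. Then the glued field `v` (`= u` on `[0, T₁]`, `= w(· - T₁)` on `(T₁, ∞)`) is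
a weak solution on `[0, T₁ + S)` from `u₀`: against a test field `ψ` on `(-∞, T₁ + S) × E` the
time integral splits at `T₁` into the final-time identity of `u`
(`IsLerayHopfOn.weakIdentity_final`, boundary term `+⟨u(T₁), ψ(T₁)⟩`) and, after `t ↦ t + T₁`,
the weak formulation of `w` against `ψ(· + T₁)` (datum term `-⟨u(T₁), ψ(T₁)⟩`)
(Robinson–Rodrigo–Sadowski 2016, §3.1 (3.1) and Def. 3.3 (ii) (3.3): the weak formulation up to an
intermediate time). [cite: RobinsonRodrigoSadowski2016, Def. 3.3 (ii) (3.3)] -/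
theorem IsLerayHopfOn.isWeakNSSolutionOn_concat (hu : IsLerayHopfOn T₁ ν 0 u₀ u) (hν : 0 ≤ ν)
    (hT₁ : 0 < T₁) (hS : 0 < S) (hw : IsLerayHopfOn S ν 0 (u T₁) w) :
    IsWeakNSSolutionOn (T₁ + S) ν 0 u₀ (fun t => if t ≤ T₁ then u t else w (t - T₁)) := by
  set v : ℝ → E → E := fun t => if t ≤ T₁ then u t else w (t - T₁) with hv
  have hv_le : ∀ t, t ≤ T₁ → v t = u t := fun t ht => by simp only [hv, if_pos ht]
  have hv_gt : ∀ t, T₁ < t → v t = w (t - T₁) := fun t ht => by simp only [hv, if_neg (not_le.2 ht)]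
  obtain ⟨humeas, huL2, hudiv, -⟩ := hu.weak
  obtain ⟨hwmeas, hwL2, hwdiv, hwweak⟩ := hw.weak
  -- the time shift `(t, x) ↦ (t - T₁, x)` between the cylinders over `(T₁, T₁ + S)` and `(0, S)`
  have hmp : ∀ K : Set E, MeasurePreserving (fun z : ℝ × E => (z.1 + -T₁, z.2))
      ((volume : Measure (ℝ × E)).restrict (Ioo T₁ (T₁ + S) ×ˢ K))
      ((volume : Measure (ℝ × E)).restrict (Ioo 0 S ×ˢ K)) := by
    intro K
    have h := measurePreserving_timeShift_restrict (E := E) (-T₁) T₁ (T₁ + S) K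
    have e1 : T₁ + -T₁ = 0 := by ring
    have e2 : T₁ + S + -T₁ = S := by ring
    rwa [e1, e2] at h
  have hae₁ : (Ioo 0 T₁ ×ˢ (univ : Set E) : Set (ℝ × E)) =ᵐ[(volume : Measure (ℝ × E))]
      (Ioc 0 T₁ ×ˢ (univ : Set E) : Set (ℝ × E)) := by
    rw [Measure.volume_eq_prod]
    exact Measure.set_prod_ae_eq Ioo_ae_eq_Ioc EventuallyEq.rfl
  refine ⟨?_, ?_, ?_, fun ψ hψ hdiv => ?_⟩
  · -- measurability on the slab
    have hsub : Ioo 0 (T₁ + S) ×ˢ (univ : Set E) ⊆ (Ioc 0 T₁ ×ˢ univ) ∪ (Ioo T₁ (T₁ + S) ×ˢ univ) := by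
      rintro ⟨t, x⟩ ⟨ht, -⟩
      rcases le_or_gt t T₁ with h | h
      · exact Or.inl ⟨⟨ht.1, h⟩, mem_univ _⟩
      · exact Or.inr ⟨⟨h, ht.2⟩, mem_univ _⟩
    refine AEStronglyMeasurable.mono_measure ?_ (Measure.restrict_mono hsub le_rfl)
    refine aestronglyMeasurable_union_iff.2 ⟨?_, ?_⟩
    · have h1 : AEStronglyMeasurable (uncurry u)
          ((volume : Measure (ℝ × E)).restrict (Ioc 0 T₁ ×ˢ (univ : Set E))) := by
        rwa [← Measure.restrict_congr_set hae₁]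
      refine h1.congr ?_
      filter_upwards [ae_restrict_mem (measurableSet_Ioc.prod MeasurableSet.univ)] with z hz
      simp only [uncurry, hv_le z.1 hz.1.2]
    · have h1 : AEStronglyMeasurable (uncurry w ∘ fun z : ℝ × E => (z.1 + -T₁, z.2))
          ((volume : Measure (ℝ × E)).restrict (Ioo T₁ (T₁ + S) ×ˢ (univ : Set E))) :=
        hwmeas.comp_measurePreserving (hmp univ)
      refine h1.congr ?_
      filter_upwards [ae_restrict_mem (measurableSet_Ioo.prod MeasurableSet.univ)] with z hz
      simp only [comp_apply, uncurry, hv_gt z.1 hz.1.1, sub_eq_add_neg]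
  · -- local square integrability
    intro K hK
    have hsub : Ioo 0 (T₁ + S) ×ˢ K ⊆ (Ioc 0 T₁ ×ˢ K) ∪ (Ioo T₁ (T₁ + S) ×ˢ K) := by
      rintro ⟨t, x⟩ ⟨ht, hx⟩
      rcases le_or_gt t T₁ with h | h
      · exact Or.inl ⟨⟨ht.1, h⟩, hx⟩
      · exact Or.inr ⟨⟨h, ht.2⟩, hx⟩
    have haeK : (Ioo 0 T₁ ×ˢ K : Set (ℝ × E)) =ᵐ[(volume : Measure (ℝ × E))]
        (Ioc 0 T₁ ×ˢ K : Set (ℝ × E)) := by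
      rw [Measure.volume_eq_prod]
      exact Measure.set_prod_ae_eq Ioo_ae_eq_Ioc EventuallyEq.rfl
    have hA : ∫⁻ z in Ioc 0 T₁ ×ˢ K, ‖uncurry v z‖ₑ ^ 2 < ∞ := by
      rw [← setLIntegral_congr haeK]
      have : ∫⁻ z in Ioo 0 T₁ ×ˢ K, ‖uncurry v z‖ₑ ^ 2 = ∫⁻ z in Ioo 0 T₁ ×ˢ K, ‖uncurry u z‖ₑ ^ 2 :=
        setLIntegral_congr_fun (measurableSet_Ioo.prod hK.measurableSet) fun z hz => by
          simp only [uncurry, hv_le z.1 hz.1.2.le]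
      rw [this]
      exact huL2 K hK
    have hB : ∫⁻ z in Ioo T₁ (T₁ + S) ×ˢ K, ‖uncurry v z‖ₑ ^ 2 < ∞ := by
      have h := (hmp K).lintegral_comp_emb (measurableEmbedding_timeShift (-T₁))
        (fun z => ‖uncurry w z‖ₑ ^ 2)
      have h' : ∫⁻ z in Ioo T₁ (T₁ + S) ×ˢ K, ‖uncurry v z‖ₑ ^ 2 =
          ∫⁻ z in Ioo T₁ (T₁ + S) ×ˢ K, ‖uncurry w (z.1 + -T₁, z.2)‖ₑ ^ 2 :=
        setLIntegral_congr_fun (measurableSet_Ioo.prod hK.measurableSet) fun z hz => by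
          simp only [uncurry, hv_gt z.1 hz.1.1, sub_eq_add_neg]
      rw [h']
      exact h.trans_lt (hwL2 K hK)
    calc ∫⁻ z in Ioo 0 (T₁ + S) ×ˢ K, ‖uncurry v z‖ₑ ^ 2
        ≤ ∫⁻ z in (Ioc 0 T₁ ×ˢ K) ∪ (Ioo T₁ (T₁ + S) ×ˢ K), ‖uncurry v z‖ₑ ^ 2 :=
          lintegral_mono_set hsub
      _ ≤ (∫⁻ z in Ioc 0 T₁ ×ˢ K, ‖uncurry v z‖ₑ ^ 2) +
            ∫⁻ z in Ioo T₁ (T₁ + S) ×ˢ K, ‖uncurry v z‖ₑ ^ 2 := lintegral_union_le _ _ _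
      _ < ∞ := ENNReal.add_lt_top.2 ⟨hA, hB⟩
  · -- divergence-free slices, a.e.
    refine ae_restrict_Ioo_of_Ioo_of_Ioo (b := T₁) ?_ ?_
    · filter_upwards [hudiv, ae_restrict_mem measurableSet_Ioo] with t ht ht'
      rwa [hv_le t ht'.2.le]
    · have h := ae_restrict_Ioo_sub_transport T₁ hwdiv
      rw [zero_add, add_comm S T₁] at h
      filter_upwards [h, ae_restrict_mem measurableSet_Ioo] with t ht ht'
      rwa [hv_gt t ht'.1]
  · -- the weak identity
    set F : ℝ → ℝ := fun t => ∫ x, (⟪v t x, timeDeriv ψ t x⟫ + ⟪v t x, convect (v t) (ψ t) x⟫ +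
      ν * ⟪v t x, Δ (ψ t) x⟫ + ⟪(0 : ℝ → E → E) t x, ψ t x⟫) with hF
    set Fu : ℝ → ℝ := fun t => ∫ x, (⟪u t x, timeDeriv ψ t x⟫ + ⟪u t x, convect (u t) (ψ t) x⟫ +
      ν * ⟪u t x, Δ (ψ t) x⟫ + ⟪(0 : ℝ → E → E) t x, ψ t x⟫) with hFu
    -- the shifted test field `ψ(· + T₁)` on `(-∞, S) × E`
    set ψs : ℝ → E → E := fun t x => ψ (t + T₁) x with hψs_def
    have hψs : IsSpaceTimeTestOn (slab E (Iio S) isOpen_Iio) ψs := by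
      have h := hψ.comp_add_time_Iio (s := T₁)
      rwa [add_sub_cancel_left] at h
    have hdivs : ∀ t, VectorCalculus.IsDivFree (ψs t) := fun t => hdiv (t + T₁)
    set Fw : ℝ → ℝ := fun t => ∫ x, (⟪w t x, timeDeriv ψs t x⟫ + ⟪w t x, convect (w t) (ψs t) x⟫ +
      ν * ⟪w t x, Δ (ψs t) x⟫ + ⟪(0 : ℝ → E → E) t x, ψs t x⟫) with hFw
    -- the two pieces
    have hpiece₁ : (∫ t in Ioo 0 T₁, F t) + ∫ x, ⟪u₀ x, ψ 0 x⟫ = ∫ x, ⟪u T₁ x, ψ T₁ x⟫ := by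
      have h1 : ∫ t in Ioo 0 T₁, F t = ∫ t in Ioo 0 T₁, Fu t :=
        setIntegral_congr_fun measurableSet_Ioo fun t ht => by
          simp only [hF, hFu, hv_le t ht.2.le]
      rw [h1]
      exact hu.weakIdentity_final hν hT₁ hψ hdiv
    have hpiece₂ : (∫ t in Ioo T₁ (T₁ + S), F t) + ∫ x, ⟪u T₁ x, ψ T₁ x⟫ = 0 := by
      have key := hwweak ψs hψs hdivs
      have h0 : ψs 0 = ψ T₁ := by
        funext x
        simp only [hψs_def, zero_add]
      rw [h0] at key
      have hcv := setIntegral_Ioo_comp_add_right F 0 S T₁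
      rw [zero_add, add_comm S T₁] at hcv
      have h1 : ∫ t in Ioo 0 S, F (t + T₁) = ∫ t in Ioo 0 S, Fw t :=
        setIntegral_congr_fun measurableSet_Ioo fun t ht => by
          have hvt : v (t + T₁) = w t := by
            rw [hv_gt (t + T₁) (by linarith [ht.1]), add_sub_cancel_right]
          have hder : ∀ y, timeDeriv ψs t y = timeDeriv ψ (t + T₁) y := fun y =>
            timeDeriv_comp_add_time_apply ψ T₁ t y
          have hsl : ψs t = ψ (t + T₁) := rfl
          simp only [hF, hFw, hvt, hder, hsl, Pi.zero_apply]
      rw [← hcv, h1]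
      exact key
    -- integrability of the two pieces and the split at `T₁`
    have hint₁ : IntegrableOn F (Ioc 0 T₁) := by
      rw [integrableOn_Ioc_iff_integrableOn_Ioo]
      have h : IntegrableOn Fu (Ioo 0 T₁) := integrableOn_testedIntegrand humeas huL2 hψ ν
      exact h.congr_fun (fun t ht => by simp only [hF, hFu, hv_le t ht.2.le]) measurableSet_Ioo
    have hint₂ : IntegrableOn F (Ioo T₁ (T₁ + S)) := by
      have h : IntegrableOn Fw (Ioo 0 S) := integrableOn_testedIntegrand hwmeas hwL2 hψs ν
      have h2 : IntegrableOn (fun t => F (t + T₁)) (Ioo 0 S) :=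
        h.congr_fun (fun t ht => by
          have hvt : v (t + T₁) = w t := by
            rw [hv_gt (t + T₁) (by linarith [ht.1]), add_sub_cancel_right]
          have hder : ∀ y, timeDeriv ψs t y = timeDeriv ψ (t + T₁) y := fun y =>
            timeDeriv_comp_add_time_apply ψ T₁ t y
          have hsl : ψs t = ψ (t + T₁) := rfl
          simp only [hF, hFw, hvt, hder, hsl, Pi.zero_apply]) measurableSet_Ioo
      have h3 : IntervalIntegrable (fun t => F (t + T₁)) volume 0 S :=
        (intervalIntegrable_iff_integrableOn_Ioo_of_le hS.le).2 h2
      have h4 := h3.comp_sub_right T₁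
      simp only [sub_add_cancel, zero_add] at h4
      rw [add_comm S T₁] at h4
      exact (intervalIntegrable_iff_integrableOn_Ioo_of_le (by linarith)).1 h4
    have hsplit : ∫ t in Ioo 0 (T₁ + S), F t = (∫ t in Ioo 0 T₁, F t) + ∫ t in Ioo T₁ (T₁ + S), F t := by
      rw [← Ioc_union_Ioo_eq_Ioo hT₁.le (by linarith : T₁ < T₁ + S),
        setIntegral_union (disjoint_left.2 fun t h1 h2 => (not_lt.2 h1.2) h2.1)
          measurableSet_Ioo hint₁ hint₂, integral_Ioc_eq_integral_Ioo]
    show (∫ t in Ioo 0 (T₁ + S), F t) + ∫ x, ⟪u₀ x, ψ 0 x⟫ = 0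
    rw [hsplit]
    linarith

end ConcatWeak

/-! ### Concatenation: the Leray–Hopf structure -/

section Concat

variable {E : Type*} [NormedAddCommGroup E] [InnerProductSpace ℝ E] [FiniteDimensional ℝ E]
  [MeasurableSpace E] [BorelSpace E]
variable {T₁ S ν : ℝ} {u w : ℝ → E → E} {u₀ : E → E}

/-- **Concatenation of Leray–Hopf weak solutions (unforced).** Let `u` be a Leray–Hopf weak
solution of the Navier–Stokes system with viscosity `ν ≥ 0` and zero force on `[0, T₁)` from `u₀`,
and `w` a Leray–Hopf weak solution on `[0, S)` from the final slice `u(T₁)` (which lies in `L²`,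
`IsLerayHopfOn.memLp`). Then the glued field — `u` on `[0, T₁]`, `w(· - T₁)` afterwards — is a
Leray–Hopf weak solution on `[0, T₁ + S)` from `u₀`: the weak formulation is
`IsLerayHopfOn.isWeakNSSolutionOn_concat`; the weak gradient is glued likewise; the energy
inequality from `0` (resp. from a.e. `s < T₁`) up to a time `t > T₁` is the sum of the inequality of
`u` on `[s, T₁]` and of `w` on `[0, t - T₁]` (the junction value `½‖u(T₁)‖²` cancels), and from a.e.
`s > T₁` it is the inequality of `w`; weak continuity across `T₁` holds because `w` attains its datum
`u(T₁)` weakly at `0⁺`. This is the continuation step of Leray's construction of a solution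
"turbulente" for all times (Leray 1934, §31, *Théorème d'existence*, Acta Math. 63, p. 241) and
the standard remark that Leray–Hopf weak solutions — weak solutions with the strong energy
inequality from `s = 0` and almost every `s` (Robinson–Rodrigo–Sadowski 2016, Def. 4.9; existence on
`ℝ³`, Thm. 14.4) — can be restarted from almost every time and glued. [cite: Leray1934, §31] -/
theorem IsLerayHopfOn.concat (hu : IsLerayHopfOn T₁ ν 0 u₀ u) (hν : 0 ≤ ν) (hT₁ : 0 < T₁)
    (hS : 0 < S) (hw : IsLerayHopfOn S ν 0 (u T₁) w) :
    IsLerayHopfOn (T₁ + S) ν 0 u₀ (fun t => if t ≤ T₁ then u t else w (t - T₁)) := by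
  have hweak := hu.isWeakNSSolutionOn_concat hν hT₁ hS hw
  set v : ℝ → E → E := fun t => if t ≤ T₁ then u t else w (t - T₁) with hv
  have hv_le : ∀ t, t ≤ T₁ → v t = u t := fun t ht => by simp only [hv, if_pos ht]
  have hv_gt : ∀ t, T₁ < t → v t = w (t - T₁) := fun t ht => by simp only [hv, if_neg (not_le.2 ht)]
  have hTS : T₁ < T₁ + S := by linarith
  -- the force terms vanish
  have hf0 : ∀ (g : ℝ → E → E) (a b : ℝ),
      ∫ τ in a..b, ∫ x, ⟪(0 : ℝ → E → E) τ x, g τ x⟫ = 0 := by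
    intro g a b
    simp
  obtain ⟨Gu, hGu1, hGu2, hGu3, hGu4⟩ := hu.weakGrad_energy
  obtain ⟨Gw, hGw1, hGw2, hGw3, hGw4⟩ := hw.weakGrad_energy
  -- the glued weak gradient and the dissipation densities
  set Gv : ℝ → E → E →L[ℝ] E := fun t => if t ≤ T₁ then Gu t else Gw (t - T₁) with hGv
  have hGv_le : ∀ t, t ≤ T₁ → Gv t = Gu t := fun t ht => by simp only [hGv, if_pos ht]
  have hGv_gt : ∀ t, T₁ < t → Gv t = Gw (t - T₁) := fun t ht => by
    simp only [hGv, if_neg (not_le.2 ht)]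
  set du : ℝ → ℝ≥0∞ := fun τ => ∫⁻ x, ENNReal.ofReal (frobeniusNormSq (Gu τ x)) with hdu
  set dw : ℝ → ℝ≥0∞ := fun τ => ∫⁻ x, ENNReal.ofReal (frobeniusNormSq (Gw τ x)) with hdw
  set dv : ℝ → ℝ≥0∞ := fun τ => ∫⁻ x, ENNReal.ofReal (frobeniusNormSq (Gv τ x)) with hdv
  have hdv_le : ∀ τ, τ ≤ T₁ → dv τ = du τ := fun τ h => by simp only [hdv, hdu, hGv_le τ h]
  have hdv_gt : ∀ τ, T₁ < τ → dv τ = dw (τ - T₁) := fun τ h => by simp only [hdv, hdw, hGv_gt τ h]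
  have hDv_u : ∀ a b, b ≤ T₁ → ∫⁻ τ in Ioo a b, dv τ = ∫⁻ τ in Ioo a b, du τ := fun a b hb =>
    setLIntegral_congr_fun measurableSet_Ioo fun τ hτ => hdv_le τ (hτ.2.le.trans hb)
  have hDv_w : ∀ a b, T₁ ≤ a → ∫⁻ τ in Ioo a b, dv τ = ∫⁻ τ in Ioo (a - T₁) (b - T₁), dw τ := by
    intro a b ha
    have h := setLIntegral_Ioo_comp_add_right dv (a - T₁) (b - T₁) T₁
    rw [sub_add_cancel, sub_add_cancel] at h
    rw [← h]
    exact setLIntegral_congr_fun measurableSet_Ioo fun τ hτ => by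
      rw [hdv_gt (τ + T₁) (by linarith [hτ.1]), add_sub_cancel_right]
  have hDu_fin : ∀ a b, 0 ≤ a → b ≤ T₁ → ∫⁻ τ in Ioo a b, du τ ≠ ∞ := fun a b ha hb =>
    ((lintegral_mono_set (Ioo_subset_Ioo ha hb)).trans_lt hGu2).ne
  have hDw_fin : ∀ b, b ≤ S → ∫⁻ τ in Ioo 0 b, dw τ ≠ ∞ := fun b hb =>
    ((lintegral_mono_set (Ioo_subset_Ioo_right hb)).trans_lt hGw2).ne
  refine
    { weak := hweak
      energy_bound := ?_
      memLp := ?_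
      weakGrad_energy := ⟨Gv, ?_, ?_, ?_, ?_⟩
      weak_continuous := ?_
      strong_initial := ?_ }
  · -- uniform energy bound, a.e.
    obtain ⟨C₁, hC₁⟩ := hu.energy_bound
    obtain ⟨C₂, hC₂⟩ := hw.energy_bound
    refine ⟨max C₁ C₂, ae_restrict_Ioo_of_Ioo_of_Ioo (b := T₁) ?_ ?_⟩
    · filter_upwards [hC₁, ae_restrict_mem measurableSet_Ioo] with t ht ht'
      rw [hv_le t ht'.2.le]
      exact ht.trans (ENNReal.coe_le_coe.2 (le_max_left _ _))
    · have h := ae_restrict_Ioo_sub_transport T₁ hC₂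
      rw [zero_add, add_comm S T₁] at h
      filter_upwards [h, ae_restrict_mem measurableSet_Ioo] with t ht ht'
      rw [hv_gt t ht'.1]
      exact ht.trans (ENNReal.coe_le_coe.2 (le_max_right _ _))
  · -- every slice is in `L²`
    intro t ht
    rcases le_or_gt t T₁ with h | h
    · rw [hv_le t h]
      exact hu.memLp t ⟨ht.1, h⟩
    · rw [hv_gt t h]
      exact hw.memLp (t - T₁) ⟨by linarith, by linarith [ht.2]⟩
  · -- (i) `Gv t` is the weak gradient of `v t`, a.e.
    refine ae_restrict_Ioo_of_Ioo_of_Ioo (b := T₁) ?_ ?_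
    · filter_upwards [hGu1, ae_restrict_mem measurableSet_Ioo] with t ht ht'
      rw [hv_le t ht'.2.le, hGv_le t ht'.2.le]
      exact ht
    · have h := ae_restrict_Ioo_sub_transport T₁ hGw1
      rw [zero_add, add_comm S T₁] at h
      filter_upwards [h, ae_restrict_mem measurableSet_Ioo] with t ht ht'
      rw [hv_gt t ht'.1, hGv_gt t ht'.1]
      exact ht
  · -- (ii) the gradient is square integrable on the slab
    show ∫⁻ t in Ioo 0 (T₁ + S), dv t < ∞
    rw [setLIntegral_Ioo_split dv hT₁ hTS.le, hDv_u 0 T₁ le_rfl, hDv_w T₁ (T₁ + S) le_rfl, sub_self,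
      add_sub_cancel_left]
    exact ENNReal.add_lt_top.2 ⟨hGu2, hGw2⟩
  · -- (iii) the energy inequality from time `0`
    intro t ht
    show VectorCalculus.kineticEnergy (v t) + ν * (∫⁻ τ in Ioo 0 t, dv τ).toReal ≤
      VectorCalculus.kineticEnergy u₀ + ∫ τ in (0 : ℝ)..t, ∫ x, ⟪(0 : ℝ → E → E) τ x, v τ x⟫
    rw [hf0 v 0 t, add_zero]
    rcases le_or_gt t T₁ with h | h
    · have h1 := hGu3 t ⟨ht.1, h⟩
      rw [hf0 u 0 t, add_zero] at h1
      rw [hv_le t h, hDv_u 0 t h]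
      exact h1
    · have h1 := hGu3 T₁ ⟨hT₁.le, le_rfl⟩
      rw [hf0 u 0 T₁, add_zero] at h1
      have h2 := hGw3 (t - T₁) ⟨by linarith, by linarith [ht.2]⟩
      rw [hf0 w 0 (t - T₁), add_zero] at h2
      rw [hv_gt t h, setLIntegral_Ioo_split dv hT₁ h.le, hDv_u 0 T₁ le_rfl, hDv_w T₁ t le_rfl,
        sub_self, ENNReal.toReal_add (hDu_fin 0 T₁ le_rfl le_rfl)
          (hDw_fin (t - T₁) (by linarith [ht.2])), mul_add]
      linarith
  · -- (iv) the energy inequality from almost every time `s`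
    refine ae_restrict_Ioo_of_Ioo_of_Ioo (b := T₁) ?_ ?_
    · filter_upwards [hGu4, ae_restrict_mem measurableSet_Ioo] with s hs hs' t hst
      show VectorCalculus.kineticEnergy (v t) + ν * (∫⁻ τ in Ioo s t, dv τ).toReal ≤
        VectorCalculus.kineticEnergy (v s) + ∫ τ in s..t, ∫ x, ⟪(0 : ℝ → E → E) τ x, v τ x⟫
      rw [hf0 v s t, add_zero, hv_le s hs'.2.le]
      rcases le_or_gt t T₁ with h | h
      · have h1 := hs t ⟨hst.1, h⟩
        rw [hf0 u s t, add_zero] at h1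
        rw [hv_le t h, hDv_u s t h]
        exact h1
      · have h1 := hs T₁ ⟨hs'.2.le, le_rfl⟩
        rw [hf0 u s T₁, add_zero] at h1
        have h2 := hGw3 (t - T₁) ⟨by linarith, by linarith [hst.2]⟩
        rw [hf0 w 0 (t - T₁), add_zero] at h2
        rw [hv_gt t h, setLIntegral_Ioo_split dv hs'.2 h.le, hDv_u s T₁ le_rfl, hDv_w T₁ t le_rfl,
          sub_self, ENNReal.toReal_add (hDu_fin s T₁ hs'.1.le le_rfl)
            (hDw_fin (t - T₁) (by linarith [hst.2])), mul_add]
        linarith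
    · have h := ae_restrict_Ioo_sub_transport T₁ hGw4
      rw [zero_add, add_comm S T₁] at h
      filter_upwards [h, ae_restrict_mem measurableSet_Ioo] with s hs hs' t hst
      show VectorCalculus.kineticEnergy (v t) + ν * (∫⁻ τ in Ioo s t, dv τ).toReal ≤
        VectorCalculus.kineticEnergy (v s) + ∫ τ in s..t, ∫ x, ⟪(0 : ℝ → E → E) τ x, v τ x⟫
      have hts : T₁ < t := hs'.1.trans_le hst.1
      have h1 := hs (t - T₁) ⟨by linarith [hst.1], by linarith [hst.2]⟩
      rw [hf0 w (s - T₁) (t - T₁), add_zero] at h1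
      rw [hf0 v s t, add_zero, hv_gt s hs'.1, hv_gt t hts, hDv_w s t hs'.1.le]
      exact h1
  · -- weak continuity in `L²`
    intro φ hφ
    obtain ⟨hcu, h0u⟩ := hu.weak_continuous φ hφ
    obtain ⟨hcw, h0w⟩ := hw.weak_continuous φ hφ
    refine ⟨continuousOn_Ioc_of_junction hT₁ hTS.le ?_ ?_ ?_, ?_⟩
    · exact hcu.congr fun t ht => by simp only [hv_le t ht.2]
    · have hc : ContinuousOn (fun t => ∫ x, ⟪w (t - T₁) x, φ x⟫) (Ioc T₁ (T₁ + S)) :=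
        hcw.comp (continuous_id.sub continuous_const).continuousOn fun t ht =>
          ⟨by linarith [ht.1], by linarith [ht.2]⟩
      exact hc.congr fun t ht => by simp only [hv_gt t ht.1]
    · have hshift : Tendsto (fun t : ℝ => t - T₁) (𝓝[>] T₁) (𝓝[>] 0) := by
        refine tendsto_nhdsWithin_iff.2 ⟨?_, ?_⟩
        · have h : Tendsto (fun t : ℝ => t - T₁) (𝓝 T₁) (𝓝 (T₁ - T₁)) :=
            (continuous_id.sub continuous_const).tendsto T₁
          rw [sub_self] at h
          exact h.mono_left nhdsWithin_le_nhds
        · filter_upwards [self_mem_nhdsWithin] with t ht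
          exact sub_pos.2 (mem_Ioi.1 ht)
      have h := h0w.comp hshift
      show Tendsto (fun t => ∫ x, ⟪v t x, φ x⟫) (𝓝[>] T₁) (𝓝 (∫ x, ⟪v T₁ x, φ x⟫))
      rw [hv_le T₁ le_rfl]
      refine h.congr' ?_
      filter_upwards [self_mem_nhdsWithin] with t ht
      simp only [comp_apply, hv_gt t ht]
    · refine h0u.congr' ?_
      filter_upwards [Ioo_mem_nhdsGT hT₁] with t ht
      simp only [hv_le t ht.2.le]
  · -- strong attainment of the datum
    refine hu.strong_initial.congr' ?_
    filter_upwards [Ioo_mem_nhdsGT hT₁] with t ht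
    simp only [hv_le t ht.2.le]

/-- **The final slice of a Leray–Hopf solution is weakly divergence free**: the slices `u(t)`,
a.e. `t ∈ (0, T)`, are weakly divergence free, and `t ↦ ∫ ⟪u(t), ∇θ⟫` is continuous on `(0, T]`
for a test function `θ` (weak `L²` continuity against `∇θ ∈ L²`), so it vanishes at `t = T` as well
— `u(T)` is the weak `L²` limit of the slices `u(t)`, `t → T` (Robinson–Rodrigo–Sadowski 2016,
Thm. 3.8 and Cor. 3.9), and the weakly divergence-free fields form a weakly closed subspace.
[cite: RobinsonRodrigoSadowski2016, Cor. 3.9] -/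
theorem IsLerayHopfOn.isWeaklyDivFree_final {T : ℝ} {f : ℝ → E → E} (hLH : IsLerayHopfOn T ν f u₀ u)
    (hT : 0 < T) : IsWeaklyDivFree (u T) := by
  intro θ hθ
  have heq : (fun y => gradient θ y) = (InnerProductSpace.toDual ℝ E).symm ∘ fun y => fderiv ℝ θ y :=
    rfl
  have hgc : Continuous fun y => gradient θ y := by
    rw [heq]
    exact (LinearIsometryEquiv.continuous _).comp (hθ.contDiff.continuous_fderiv (by simp))
  have hgs : HasCompactSupport fun y => gradient θ y := by
    rw [heq]
    exact (hθ.hasCompactSupport.fderiv ℝ).comp_left (map_zero _)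
  have hmem : MemLp (fun y => gradient θ y) 2 volume := hgc.memLp_of_hasCompactSupport hgs
  have hcont := (hLH.weak_continuous _ hmem).1
  have hae : ∀ᵐ t ∂((volume : Measure ℝ).restrict (Ioc 0 T)), ∫ x, ⟪u t x, gradient θ x⟫ = 0 := by
    rw [← Measure.restrict_congr_set (Ioo_ae_eq_Ioc (μ := (volume : Measure ℝ)))]
    filter_upwards [hLH.weak.2.2.1] with t ht
    exact ht θ hθ
  exact Measure.eqOn_Ioc_of_ae_eq (μ := (volume : Measure ℝ)) (g := fun _ => (0 : ℝ)) hae hcont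
    continuousOn_const ⟨hT, le_rfl⟩

end Concat

/-! ### Global continuation on `ℝ³` and the unconditional reductions of non-uniqueness -/

section Extension

variable {T ν : ℝ} {u : ℝ → EuclideanSpace ℝ (Fin 3) → EuclideanSpace ℝ (Fin 3)}
  {u₀ : EuclideanSpace ℝ (Fin 3) → EuclideanSpace ℝ (Fin 3)}

/-- **Global continuation of Leray–Hopf solutions on `ℝ³` (unforced).** Every Leray–Hopf weak
solution `u` of the Navier–Stokes system with viscosity `ν > 0` and zero force on `ℝ³ × [0, T)`,
`T > 0`, from `u₀` agrees on `(0, T]` with a global Leray–Hopf weak solution from `u₀`: the final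
slice `u(T)` is in `L²` and weakly divergence free (`IsLerayHopfOn.memLp`,
`IsLerayHopfOn.isWeaklyDivFree_final`), Leray's existence theorem (the accepted fact
`leray_existence_R3`, proved in the tree) gives a global Leray–Hopf solution `w` from `u(T)`, and
`u` glued with `w(· - T)` is Leray–Hopf on every `[0, T')` (`IsLerayHopfOn.concat` on `[0, T + T')`,
then restriction). This is the continuation hypothesis `hext` of
`LerayHopfNonUniqueness.of_isLerayHopfOn` ("It is elementary to extend the distinct solutions to
global-in-time Leray–Hopf solutions by modifying the force after `T` and using Leray's result",
Albritton–Brué–Colombo 2022, after Thm. 1.2 — here the force is zero throughout; Leray 1934, §31,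
*Théorème d'existence*). [cite: Leray1934, §31] -/
theorem IsLerayHopfOn.exists_isGlobalLerayHopf_extension (hν : 0 < ν) (hT : 0 < T)
    (hu : IsLerayHopfOn T ν 0 u₀ u) :
    ∃ w : ℝ → EuclideanSpace ℝ (Fin 3) → EuclideanSpace ℝ (Fin 3), IsGlobalLerayHopf ν 0 u₀ w ∧ ∀ t ∈ Ioc 0 T, w t = u t := by
  have hmemT : MemLp (u T) 2 volume := hu.memLp T ⟨hT.le, le_rfl⟩
  have hdivT : IsWeaklyDivFree (u T) := hu.isWeaklyDivFree_final hT
  obtain ⟨w, hw⟩ := leray_existence_R3_holds ν hν (u T) hmemT hdivT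
  refine ⟨fun t => if t ≤ T then u t else w (t - T), fun T' hT' => ?_, fun t ht => if_pos ht.2⟩
  exact (hu.concat hν.le hT hT' (hw T' hT')).of_le (by linarith)

/-- **Reduction of ns.S19 to local-in-time non-uniqueness, unconditionally.** Two strict-sense
Leray–Hopf weak solutions of the unforced system on `ℝ³ × [0, T)` with viscosity `ν > 0` and the
same weakly divergence-free datum `u₀ ∈ L²`, differing on a set of positive measure at some
`t ∈ (0, T]`, give `LerayHopfNonUniqueness`: `LerayHopfNonUniqueness.of_isLerayHopfOn` with its
continuation hypothesis `hext` discharged by `IsLerayHopfOn.exists_isGlobalLerayHopf_extension`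
(the reduction printed after Albritton–Brué–Colombo 2022, Thm. 1.2: "It is elementary to extend the
distinct solutions to global-in-time Leray–Hopf solutions … using Leray's result").
[cite: AlbrittonBrueColombo2022, remark after Thm. 1.2] -/
theorem LerayHopfNonUniqueness.of_isLerayHopfOn_of_not_ae_eq (hν : 0 < ν) {v : ℝ → EuclideanSpace ℝ (Fin 3) → EuclideanSpace ℝ (Fin 3)}
    (hu₀ : MemLp u₀ 2 volume) (hdiv : IsWeaklyDivFree u₀) (hu : IsLerayHopfOn T ν 0 u₀ u)
    (hv : IsLerayHopfOn T ν 0 u₀ v) (hne : ∃ t ∈ Ioc 0 T, ¬ (u t =ᵐ[volume] v t)) :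
    LerayHopfNonUniqueness := by
  have hT : 0 < T := by
    obtain ⟨t, ht, -⟩ := hne
    exact ht.1.trans_le ht.2
  exact LerayHopfNonUniqueness.of_isLerayHopfOn hν hu₀ hdiv hu hv hne fun _ hu' =>
    hu'.exists_isGlobalLerayHopf_extension hν hT

/-- **Reduction of ns.S19 to the Hou–Wang–Yang claim, unconditionally**: a Hou–Wang–Yang family
(`HouWangYang2025.IsNonuniqueFamily`, the object of the unrefereed claim arXiv:2509.25116, Thm. 1 —
nothing about its existence is asserted here) yields `LerayHopfNonUniqueness`, the continuation
hypothesis of `HouWangYang2025.IsNonuniqueFamily.lerayHopfNonUniqueness` being discharged by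
`IsLerayHopfOn.exists_isGlobalLerayHopf_extension` (the continuation step printed after
Albritton–Brué–Colombo 2022, Thm. 1.2). [cite: AlbrittonBrueColombo2022, remark after Thm. 1.2] -/
theorem HouWangYang2025.IsNonuniqueFamily.toLerayHopfNonUniqueness {U : ℕ → ℝ → EuclideanSpace ℝ (Fin 3) → EuclideanSpace ℝ (Fin 3)}
    (h : HouWangYang2025.IsNonuniqueFamily u₀ U) : LerayHopfNonUniqueness :=
  h.lerayHopfNonUniqueness fun _ hu' => hu'.exists_isGlobalLerayHopf_extension one_pos one_pos

/-- **Reduction of the energy-class variant `W_E` to the Hou–Wang–Yang claim, unconditionally**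
(`HouWangYang2025.IsNonuniqueFamily.energyClassNonUniqueness` with `hext` discharged by the
continuation step printed after Albritton–Brué–Colombo 2022, Thm. 1.2).
[cite: AlbrittonBrueColombo2022, remark after Thm. 1.2] -/
theorem HouWangYang2025.IsNonuniqueFamily.toEnergyClassNonUniqueness {U : ℕ → ℝ → EuclideanSpace ℝ (Fin 3) → EuclideanSpace ℝ (Fin 3)}
    (h : HouWangYang2025.IsNonuniqueFamily u₀ U) : EnergyClassNonUniqueness :=
  h.energyClassNonUniqueness fun _ hu' => hu'.exists_isGlobalLerayHopf_extension one_pos one_pos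

end Extension

end Literature.Analysis.FluidPDE
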